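import Summits.BirchSwinnertonDyer.BirchSwinnertonDyer.Theorems.EisensteinPrimesBSDpOnCellCStubC3RoadH
import Summits.BirchSwinnertonDyer.BirchSwinnertonDyer.Theorems.EisensteinPrimesHidaLimitFittingBound
import HarnessLib

/-!
# Crux 4 `BSDpOnCellC` (stmt-BirchSwinnertonDyer-19034), line b1 (v7 `61c171a5`), stub `stub_c3`: road H's
# typed inputs WITH THE FINITE-SUBMODULE BOUND DISCHARGED — `stub_c3` from [`X_ac^∅` is `Λ`-torsion] ∧
# [member data] ∧ [Keller–Yin D′], both signs, wide receptacle (cell `bsd-eis`, seat `bsd-eis-c3h` g0)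

HONEST FRAMING (cell `bsd-eis`, run/shared/lean/pub/bsd-eis/): theorems only; nothing booked; X2 stays
CONSTRUCTION-SHAPED; no label or count moves; BSD is not proved by any of this. CONDITIONAL on the member
data of road H (hypothesis-shaped; provenance Keller–Yin arXiv:2402.12781v2 §5.1 (a)–(e) [PRE] + cgshw MEMO-8
((d)∞) / MEMO-9 ((α)) + Castella JIMJ 19 (2020) §1.5 ((b))), on the `Λ`-torsionness of `X_ac^∅(E[p^∞])` at the
X2c Heegner data (part of every printed IMC statement at `p ‖ N`, e.g. Castella Camb. J. Math. 6 (2018) Thm. 2.3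
"is `Λ`-torsion"; NOT in refereed print at a residually reducible `p ‖ N`), and on KY D′♭ [PRE].

## What

`X2.HidaLimitInputsIntAt W p` (cgshw g8, p431128) = for every X2c Heegner datum, every `𝓞_{ℂ_p}`-frame `Q`
and every generator `F` of `Ch_Λ(X_ac^∅)`: [KY Lemma 5.1.2's bound `∃ a, (p)^a·(F) ⊆ Fitt_Λ(X_ac^∅)`] ∧
[member data: `∀ m ≥ 1 ∃ N_m, Q_m` with `X_ac^∅/p^m ≅ N_m/p^m`, `Fitt_Λ(N_m)·𝓞_{ℂ_p}⟦T⟧ ⊆ (Q_m)`,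
`(Q_m) + (p)^m = (Q) + (p)^m`]. The first conjunct is now a THEOREM for torsion modules
(`Theorems.exists_span_C_pow_mul_span_le_fittingIdeal_zero`, file `EisensteinPrimesHidaLimitFittingBound`),
and `X_ac^∅` is finitely generated in the kernel (`XAc.module_finite_empty`). Hence:

* `hidaLimitInputsIntAt_of_isTorsion_of_memberDataInt` — [torsion ∧ member data] (stated INLINE on the
  binders of `HidaLimitInputsIntAt`; no new `Prop`) ⟹ `X2.HidaLimitInputsIntAt W p`;
* `hidaLimitInputsIntAt_of_isTorsion_of_map_fittingIdeal_le` — honesty lemma: the inputs predicate is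
  already implied by [torsion ∧ `Fitt_Λ(X_ac^∅)·𝓞_{ℂ_p}⟦T⟧ ⊆ (Q)` for every frame] (trivial member data), so
  its KERNEL content is the reverse divisibility in Fitting form — the Hida-limit provenance is docstring;
* `stub_c3_of_isTorsion_of_memberDataInt_of_muLambdaInt` — the registered `stub_c3` signature VERBATIM from
  [torsion ∧ member data] at every X2c pair + D′♭ at each sign (through p454543's
  `stub_c3_of_hidaLimitInputsInt_of_muLambdaInt`).

So road H's typed residual for the IMC atom c3/c3s reads, in the kernel: TORSION of `X_ac^∅` + the three
member-data fields ((α)+control, (d), (b)♭) + D′ — Keller–Yin Lemma 5.1.2 is no longer an input. What this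
is NOT: not a proof of torsion-ness, of any member-data field, or of D′.

References: [KellerYin2024] §5.1, Lemma 5.1.2, Thm. 5.1.3 (arXiv:2402.12781v2, PRE); [Castella2018] Thm. 2.3
(arXiv:1704.06608 p. 5); [Skinner2016PacificMC] §3.1; [Washington1997] §13.2; cell memos cgshw MEMO-8/9/10.
-/

set_option autoImplicit false
set_option linter.dupNamespace false

noncomputable section

open scoped Classical MatrixGroups ModularForm

open CongruenceSubgroup WeierstrassCurve NumberField IsDedekindDomain Field PowerSeries
  Literature.RingTheory.FittingIdeal
  Literature.NumberTheory.EllipticCurves Literature.NumberTheory.EllipticCurves.GreenbergSelmer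
  Literature.NumberTheory.EllipticCurves.ModularForms
  Literature.NumberTheory.EllipticCurves.Rank1Residual
  Literature.NumberTheory.EllipticCurves.Rank1Residual.Typed
  Literature.NumberTheory.GaloisRepresentations Literature.NumberTheory.GaloisCohomology
  Literature.NumberTheory.Automorphic
  Summit.BirchSwinnertonDyer.Rank1Residual.X11b.AcSelmer
  Summit.BirchSwinnertonDyer.Rank1Residual.X11b.Halves
  Summit.BirchSwinnertonDyer.Rank1Residual.X11b
  Summit.BirchSwinnertonDyer.Rank1Residual.X2

namespace Summit.BirchSwinnertonDyer.BirchSwinnertonDyer.Theorems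

/-! ### §1 Road H's inputs from torsion + member data (the finite-submodule bound discharged) -/

section TorsionForm

variable {W : WeierstrassCurve ℚ} [W.IsElliptic] [W.IsGloballyMinimal] {p : ℕ} [Fact p.Prime]

omit [W.IsGloballyMinimal] in
/-- **`HidaLimitInputsIntAt` from [torsion] ∧ [member data].** On the binders of `X2.HidaLimitInputsIntAt W p`
(X2c Heegner datum, anticyclotomic `κ`/`γ`, degree-one `𝔭`, newform, embedding datum, `𝓞_{ℂ_p}`-frame
`(Ω_K, Ω_p, Q)`): IF `X_ac^∅(E[p^∞])` is `Λ`-torsion and the member data hold for `Q` (`∀ m ≥ 1 ∃ N_m, Q_m`: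
`X_ac^∅/p^m ≅ N_m/p^m`, `Fitt_Λ(N_m)·𝓞_{ℂ_p}⟦T⟧ ⊆ (Q_m)`, `(Q_m) + (p)^m = (Q) + (p)^m`), THEN road H's typed
inputs hold there — the finite-submodule conjunct `∃ a, (p)^a·(F) ⊆ Fitt_Λ(X_ac^∅)` for every generator `F`
of `Ch_Λ(X_ac^∅)` is the kernel theorem `exists_span_C_pow_mul_span_le_fittingIdeal_zero` (Keller–Yin
Lemma 5.1.2 discharged; `X_ac^∅` f.g. by `XAc.module_finite_empty`). The hypothesis is stated INLINE (no
new `Prop`). CONDITIONAL on torsion + member data; nothing booked.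
[cite: KellerYin2024, §5.1 (a)–(e) and Lemma 5.1.2 (arXiv:2402.12781v2)] [cite: Washington1997, §13.2]
[cite: Castella2018, Thm. 2.3 (arXiv:1704.06608 p. 5) ("is Λ-torsion", shape only)] -/
theorem hidaLimitInputsIntAt_of_isTorsion_of_memberDataInt
    (h : ∀ (N : ℕ) [NeZero N] (K : Type) [Field K] [NumberField K] (Dt : ModularParametrizationData W N)
      (H : HeegnerDatum N (NumberField.discr K)) (ιK : K →+* ℂ) (P : (W.baseChange K).toAffine.Point),
      CellC W p → W.conductorNorm ℤ = N →
      IsImaginaryQuadratic K → NumberField.discr K < -4 → SatisfiesHeegnerHypothesis N K →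
      (W.quadraticTwist (NumberField.discr K : ℚ)).entireLFunction 1 ≠ 0 →
      WeierstrassCurve.Affine.Point.map ιK.toRatAlgHom P = heegnerPointComplex Dt H →
      ¬ (p : ℤ) ∣ Dt.c → ¬ IsOfFinAddOrder P →
      ∀ (κ : ZpExtension K p), κ.IsAnticyclotomic →
        ∀ (γ : Field.absoluteGaloisGroup K) [Fact (κ.IsTopGenerator γ)]
          (𝔭 : HeightOneSpectrum (𝓞 K)), ((p : ℕ) : 𝓞 K) ∈ 𝔭.asIdeal →
          𝔭.asIdeal.ramificationIdx (𝓞 ℚ) = 1 → 𝔭.asIdeal.inertiaDeg (𝓞 ℚ) = 1 →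
          ∀ (f : CuspForm (CongruenceSubgroup.Gamma0 N) 2), IsNewformOf W f →
            ∀ (ι' : PadicAlgCl p ≃+* ℂ),
              (∀ (w : InfinitePlace K) (k : 𝓞 K),
                k ∈ 𝔭.asIdeal ↔ ‖ι'.symm (w.embedding (k : K))‖ < 1) →
              ∀ (ΩK : ℂ) (Ωp : ℂ_[p]) (Q : PowerSeries 𝓞_ℂ_[p]), ΩK ≠ 0 → ‖Ωp‖ = 1 →
                R1.IsBDPLFunctionInt p ι' 𝔭 κ γ f ΩK Ωp Q →
                  Module.IsTorsion (IwasawaAlgebra p) (XAc (W.baseChange K) p κ 𝔭 ∅ γ) ∧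
                  ∀ m : ℕ, 1 ≤ m →
                    ∃ (Nm : Type) (_ : AddCommGroup Nm) (_ : Module (IwasawaAlgebra p) Nm)
                      (_ : Module.Finite (IwasawaAlgebra p) Nm) (Qm : PowerSeries 𝓞_ℂ_[p]),
                      Nonempty (((XAc (W.baseChange K) p κ 𝔭 ∅ γ) ⧸
                          ((Ideal.span {(C (p : ℤ_[p]) : IwasawaAlgebra p)}) ^ m •
                            (⊤ : Submodule (IwasawaAlgebra p) (XAc (W.baseChange K) p κ 𝔭 ∅ γ))))
                          ≃ₗ[IwasawaAlgebra p]
                        (Nm ⧸ ((Ideal.span {(C (p : ℤ_[p]) : IwasawaAlgebra p)}) ^ m •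
                          (⊤ : Submodule (IwasawaAlgebra p) Nm)))) ∧
                      (Module.fittingIdeal (IwasawaAlgebra p) Nm 0).map
                          (PowerSeries.map (R1.toCpInt p)) ≤ Ideal.span {Qm} ∧
                      Ideal.span {Qm} ⊔
                          (Ideal.span {(C ((p : ℕ) : 𝓞_ℂ_[p]) : PowerSeries 𝓞_ℂ_[p])}) ^ m =
                        Ideal.span {Q} ⊔
                          (Ideal.span {(C ((p : ℕ) : 𝓞_ℂ_[p]) : PowerSeries 𝓞_ℂ_[p])}) ^ m) :
    HidaLimitInputsIntAt W p := by
  intro N _ K _ _ Dt H ιK P hc hN hK hd4 hHN hLt hP hcM hPinf κ hκ γ _ 𝔭 h𝔭 he hf f hfW ι' hι'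
    ΩK Ωp Q hΩK hΩp hQ F hchar
  obtain ⟨htor, hmem⟩ := h N K Dt H ιK P hc hN hK hd4 hHN hLt hP hcM hPinf κ hκ γ 𝔭 h𝔭 he hf f hfW
    ι' hι' ΩK Ωp Q hΩK hΩp hQ
  haveI : Module.Finite (IwasawaAlgebra p) (XAc (W.baseChange K) p κ 𝔭 ∅ γ) :=
    XAc.module_finite_empty κ 𝔭 γ
  exact ⟨exists_span_C_pow_mul_span_le_fittingIdeal_zero (p := p) (XAc (W.baseChange K) p κ 𝔭 ∅ γ)
    htor hchar, hmem⟩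

omit [W.IsGloballyMinimal] in
/-- **What the member data amount to in the kernel (honesty lemma).** Road H's typed inputs are IMPLIED
by the single divisibility "`Fitt_Λ(X_ac^∅)·𝓞_{ℂ_p}⟦T⟧ ⊆ (Q)` for every `𝓞_{ℂ_p}`-frame `Q`" together with
the torsion clause: take the TRIVIAL member data `N_m := X_ac^∅`, `Q_m := Q` at every level (identity
isomorphism, equal ideals). So the kernel content of `X2.HidaLimitInputsIntAt` is the REVERSE divisibility
in Fitting form; its Hida-theoretic provenance ((α)+control, (d), (b) — where the member data are the
weight-`k_m` Selmer modules and BDP functions, cgshw MEMO-8/9, KY §5.1) lives in the docstrings, not in the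
type. Conversely road H's transfer (`X2.C_pow_mul_map_mem_of_memberDataInt`, p431128) turns genuine member
data + a unit coefficient of `Q` into exactly this divisibility up to `p^a`. Recorded for the census of
line b1; CONDITIONAL; nothing booked. [folklore]
[cite: KellerYin2024, §5.1 (a)–(e) and Lemma 5.1.2 (arXiv:2402.12781v2) (shape only)] -/
theorem hidaLimitInputsIntAt_of_isTorsion_of_map_fittingIdeal_le
    (h : ∀ (N : ℕ) [NeZero N] (K : Type) [Field K] [NumberField K] (Dt : ModularParametrizationData W N)
      (H : HeegnerDatum N (NumberField.discr K)) (ιK : K →+* ℂ) (P : (W.baseChange K).toAffine.Point),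
      CellC W p → W.conductorNorm ℤ = N →
      IsImaginaryQuadratic K → NumberField.discr K < -4 → SatisfiesHeegnerHypothesis N K →
      (W.quadraticTwist (NumberField.discr K : ℚ)).entireLFunction 1 ≠ 0 →
      WeierstrassCurve.Affine.Point.map ιK.toRatAlgHom P = heegnerPointComplex Dt H →
      ¬ (p : ℤ) ∣ Dt.c → ¬ IsOfFinAddOrder P →
      ∀ (κ : ZpExtension K p), κ.IsAnticyclotomic →
        ∀ (γ : Field.absoluteGaloisGroup K) [Fact (κ.IsTopGenerator γ)]
          (𝔭 : HeightOneSpectrum (𝓞 K)), ((p : ℕ) : 𝓞 K) ∈ 𝔭.asIdeal →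
          𝔭.asIdeal.ramificationIdx (𝓞 ℚ) = 1 → 𝔭.asIdeal.inertiaDeg (𝓞 ℚ) = 1 →
          ∀ (f : CuspForm (CongruenceSubgroup.Gamma0 N) 2), IsNewformOf W f →
            ∀ (ι' : PadicAlgCl p ≃+* ℂ),
              (∀ (w : InfinitePlace K) (k : 𝓞 K),
                k ∈ 𝔭.asIdeal ↔ ‖ι'.symm (w.embedding (k : K))‖ < 1) →
              ∀ (ΩK : ℂ) (Ωp : ℂ_[p]) (Q : PowerSeries 𝓞_ℂ_[p]), ΩK ≠ 0 → ‖Ωp‖ = 1 →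
                R1.IsBDPLFunctionInt p ι' 𝔭 κ γ f ΩK Ωp Q →
                  Module.IsTorsion (IwasawaAlgebra p) (XAc (W.baseChange K) p κ 𝔭 ∅ γ) ∧
                  (Module.fittingIdeal (IwasawaAlgebra p) (XAc (W.baseChange K) p κ 𝔭 ∅ γ) 0).map
                      (PowerSeries.map (R1.toCpInt p)) ≤ Ideal.span {Q}) :
    HidaLimitInputsIntAt W p := by
  refine hidaLimitInputsIntAt_of_isTorsion_of_memberDataInt ?_
  intro N _ K _ _ Dt H ιK P hc hN hK hd4 hHN hLt hP hcM hPinf κ hκ γ _ 𝔭 h𝔭 he hf f hfW ι' hι'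
    ΩK Ωp Q hΩK hΩp hQ
  obtain ⟨htor, hle⟩ := h N K Dt H ιK P hc hN hK hd4 hHN hLt hP hcM hPinf κ hκ γ 𝔭 h𝔭 he hf f hfW
    ι' hι' ΩK Ωp Q hΩK hΩp hQ
  haveI : Module.Finite (IwasawaAlgebra p) (XAc (W.baseChange K) p κ 𝔭 ∅ γ) :=
    XAc.module_finite_empty κ 𝔭 γ
  exact ⟨htor, fun m _ => ⟨XAc (W.baseChange K) p κ 𝔭 ∅ γ, inferInstance, inferInstance,
    inferInstance, Q, ⟨LinearEquiv.refl _ _⟩, hle, rfl⟩⟩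

end TorsionForm

/-! ### §2 `stub_c3` VERBATIM from torsion + member data + Keller–Yin D′ -/

section StubC3

/-- **`stub_c3` (line b1 v7, crux 4 `BSDpOnCellC`) FROM [`X_ac^∅` `Λ`-torsion ∧ road-H member data] at
every X2c pair + KELLER–YIN D′♭ at each sign** — p454543's `stub_c3_of_hidaLimitInputsInt_of_muLambdaInt`
with road H's typed inputs entered through §1 (the finite-submodule bound of Keller–Yin Lemma 5.1.2 is no
longer a hypothesis: it is the kernel theorem `exists_span_C_pow_mul_span_le_fittingIdeal_zero`). The
torsion/member-data hypothesis `htm` is stated INLINE on the binders of `X2.HidaLimitInputsIntAt` (no new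
`Prop`); `hml`/`hmls` are D′♭ (`X2.NonsplitMuLambdaOnTreeInt` / `X2.SplitMuLambdaOnTreeInt`, PRE). Conclusion:
the registered `stub_c3` signature VERBATIM. CONDITIONAL-RESULT (typed ≠ proved ≠ endorsed); nothing
booked; no label or count moves. [claim: KellerYin2024, status: under-review]
[cite: KellerYin2024, §5.1 (a)–(e), Lemma 5.1.2, Thm. 5.1.3 = Thm. D (arXiv:2402.12781v2)]
[cite: Skinner2016PacificMC, §3.1 (p. 192)] [cite: Washington1997, §13.2] -/
theorem stub_c3_of_isTorsion_of_memberDataInt_of_muLambdaInt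
    (htm : ∀ (W : WeierstrassCurve ℚ) [W.IsElliptic] [W.IsGloballyMinimal] (p : ℕ) [Fact p.Prime],
      CellC W p →
      ∀ (N : ℕ) [NeZero N] (K : Type) [Field K] [NumberField K] (Dt : ModularParametrizationData W N)
        (H : HeegnerDatum N (NumberField.discr K)) (ιK : K →+* ℂ) (P : (W.baseChange K).toAffine.Point),
        CellC W p → W.conductorNorm ℤ = N →
        IsImaginaryQuadratic K → NumberField.discr K < -4 → SatisfiesHeegnerHypothesis N K →
        (W.quadraticTwist (NumberField.discr K : ℚ)).entireLFunction 1 ≠ 0 →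
        WeierstrassCurve.Affine.Point.map ιK.toRatAlgHom P = heegnerPointComplex Dt H →
        ¬ (p : ℤ) ∣ Dt.c → ¬ IsOfFinAddOrder P →
        ∀ (κ : ZpExtension K p), κ.IsAnticyclotomic →
          ∀ (γ : Field.absoluteGaloisGroup K) [Fact (κ.IsTopGenerator γ)]
            (𝔭 : HeightOneSpectrum (𝓞 K)), ((p : ℕ) : 𝓞 K) ∈ 𝔭.asIdeal →
            𝔭.asIdeal.ramificationIdx (𝓞 ℚ) = 1 → 𝔭.asIdeal.inertiaDeg (𝓞 ℚ) = 1 →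
            ∀ (f : CuspForm (CongruenceSubgroup.Gamma0 N) 2), IsNewformOf W f →
              ∀ (ι' : PadicAlgCl p ≃+* ℂ),
                (∀ (w : InfinitePlace K) (k : 𝓞 K),
                  k ∈ 𝔭.asIdeal ↔ ‖ι'.symm (w.embedding (k : K))‖ < 1) →
                ∀ (ΩK : ℂ) (Ωp : ℂ_[p]) (Q : PowerSeries 𝓞_ℂ_[p]), ΩK ≠ 0 → ‖Ωp‖ = 1 →
                  R1.IsBDPLFunctionInt p ι' 𝔭 κ γ f ΩK Ωp Q →
                    Module.IsTorsion (IwasawaAlgebra p) (XAc (W.baseChange K) p κ 𝔭 ∅ γ) ∧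
                    ∀ m : ℕ, 1 ≤ m →
                      ∃ (Nm : Type) (_ : AddCommGroup Nm) (_ : Module (IwasawaAlgebra p) Nm)
                        (_ : Module.Finite (IwasawaAlgebra p) Nm) (Qm : PowerSeries 𝓞_ℂ_[p]),
                        Nonempty (((XAc (W.baseChange K) p κ 𝔭 ∅ γ) ⧸
                            ((Ideal.span {(C (p : ℤ_[p]) : IwasawaAlgebra p)}) ^ m •
                              (⊤ : Submodule (IwasawaAlgebra p) (XAc (W.baseChange K) p κ 𝔭 ∅ γ))))
                            ≃ₗ[IwasawaAlgebra p]
                          (Nm ⧸ ((Ideal.span {(C (p : ℤ_[p]) : IwasawaAlgebra p)}) ^ m •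
                            (⊤ : Submodule (IwasawaAlgebra p) Nm)))) ∧
                        (Module.fittingIdeal (IwasawaAlgebra p) Nm 0).map
                            (PowerSeries.map (R1.toCpInt p)) ≤ Ideal.span {Qm} ∧
                        Ideal.span {Qm} ⊔
                            (Ideal.span {(C ((p : ℕ) : 𝓞_ℂ_[p]) : PowerSeries 𝓞_ℂ_[p])}) ^ m =
                          Ideal.span {Q} ⊔
                            (Ideal.span {(C ((p : ℕ) : 𝓞_ℂ_[p]) : PowerSeries 𝓞_ℂ_[p])}) ^ m)
    (hml : ∀ (W : WeierstrassCurve ℚ) [W.IsElliptic] [W.IsGloballyMinimal] (p : ℕ) [Fact p.Prime],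
      CellC W p → ¬ W.HasSplitMultiplicativeReductionAtPrime p → NonsplitMuLambdaOnTreeInt W p)
    (hmls : ∀ (W : WeierstrassCurve ℚ) [W.IsElliptic] [W.IsGloballyMinimal] (p : ℕ) [Fact p.Prime],
      CellC W p → W.HasSplitMultiplicativeReductionAtPrime p → SplitMuLambdaOnTreeInt W p) :
    (∀ (W : WeierstrassCurve ℚ) [W.IsElliptic] [W.IsGloballyMinimal] (p : ℕ) [Fact p.Prime],
      CellC W p → ¬ W.HasSplitMultiplicativeReductionAtPrime p → NonsplitIMCEqOnTreeInt W p) ∧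
    (∀ (W : WeierstrassCurve ℚ) [W.IsElliptic] [W.IsGloballyMinimal] (p : ℕ) [Fact p.Prime],
      CellC W p → W.HasSplitMultiplicativeReductionAtPrime p → SplitIMCEqOnTreeInt W p) :=
  stub_c3_of_hidaLimitInputsInt_of_muLambdaInt
    (fun W _ _ p _ hc => hidaLimitInputsIntAt_of_isTorsion_of_memberDataInt (htm W p hc)) hml hmls

end StubC3

end Summit.BirchSwinnertonDyer.BirchSwinnertonDyer.Theorems

end
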